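import Mathlib
import HarnessLib
import HarnessLib.Audit
import Summits.BirchSwinnertonDyer.Statement
import Literature.NumberTheory.EllipticCurves.GreenbergVatsal2000.EisensteinCongruenceResidualGoodOrdinary
import Literature.NumberTheory.EllipticCurves.GreenbergVatsal2000.NonPrimitiveSelmerGroup
import Literature.NumberTheory.EllipticCurves.KatoRankBound
import Literature.NumberTheory.EllipticCurves.Wuthrich2014.ReducibleDivisibility
import Literature.NumberTheory.EllipticCurves.CuspFormLFunction
import Literature.NumberTheory.EllipticCurves.PAdicLFunction
import Literature.NumberTheory.EllipticCurves.Selmer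
import Literature.NumberTheory.EllipticCurves.SelmerCorankHolds
import HarnessLib.Audit.Status.Attr

/-!
Route: EisensteinCountDoorRankTwo

# Route EisensteinCountDoorRankTwo — Eisenstein residual count = p^(2+Σδ) plus two points opens the
rank-2 p-adic BSD door

LINE (D-0145 ideator bsd-idea-4 g2, technique card «splitting / non-equivalent criterion search»;
bears_on LADDER-BSD
S0-DOORS N4 door (D) «Ш[p^∞] finite family-wise at rank 2» + the MTT rank clause; it is a DOOR, no
class theorem at rank >= 2 and
BSD is NOT proved by it). Target leaf T = InfinitelyManyRankTwoPadicBSD (route-local, born draft;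
director-bsd is asked for the rung
ruling, precedent CountingDoorF2AtThree -> T-r2): for some prime p >= 5, infinitely many (by minimal
discriminant) elliptic W/Q, good
ordinary at p, with rank W(Q) = 2, corank Ш[p^∞] = 0, corank Sel_p^∞ = 2 and ord_T L_p(f_W, α) = 2.
It suffices to show X = EisensteinCountTwoSupply,
the route's ONE open input (the second crux PublishedInputs is print, conjecture-grade only because
its five facts are unformalised): at such a p, infinitely many W with a rational p-line Φ0 ramified
and even at p whose Greenberg–Vatsal
RESIDUAL COUNT #H¹_Σ0(Φ0-side)·#Sel_Σ0(quotient side) equals p^(2+Σ_ℓ δ_ℓ) AND which carry two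
independent rational points.
PublishedInputs = five print facts (typed, unformalised); the support EisensteinCountDoorKernel =
the squeeze corank Sel <= ord_T L_p <= k is provable now from them.
Lean: `∃ (p : ℕ) (_ : Fact p.Prime), 5 ≤ p ∧ {Δ : ℚ | ∃ (W : WeierstrassCurve ℚ) (_ : W.IsElliptic)
(_ : W.IsGloballyMinimal), W.Δ = Δ ∧ W.HasGoodReductionAtPrime p ∧ ¬ (p : ℤ) ∣ W.frobeniusTrace p ∧
2 ≤ W.mordellWeilRank ∧ ∃ (Φ₀ : AddSubgroup (W.geomTorsion (p : ℤ))) (hΦ :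
NumberTheory.EllipticCurves.Rank1Residual.IsRationalLine W p Φ₀), ¬
NumberTheory.EllipticCurves.Rank1Residual.LineUnramifiedAt W p Φ₀ ∧
NumberTheory.EllipticCurves.Rank1Residual.LineEven W p Φ₀ ∧ ∃ κ :
NumberTheory.EllipticCurves.ZpExtension ℚ p, κ.IsCyclotomic ∧ ∃ S₀ : Finset
(IsDedekindDomain.HeightOneSpectrum (NumberField.RingOfIntegers ℚ)), (∀ v ∈ S₀, ((p : ℕ) :
NumberField.RingOfIntegers ℚ) ∉ v.asIdeal) ∧ (∀ v : IsDedekindDomain.HeightOneSpectrum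
(NumberField.RingOfIntegers ℚ), v ∉ S₀ → ((p : ℕ) : NumberField.RingOfIntegers ℚ) ∉ v.asIdeal →
W.HasGoodReductionAt v) ∧ Nat.card (NumberTheory.EllipticCurves.GreenbergVatsal2000.residualLineH1 W
p κ S₀ Φ₀ hΦ) * Nat.card (NumberTheory.EllipticCurves.GreenbergVatsal2000.residualQuotSelmer W p κ
S₀ Φ₀ hΦ) = p ^ (2 + ∑ v ∈ S₀, NumberTheory.EllipticCurves.GreenbergVatsal2000.delta W p
v)}.Infinite`

## Assembly
Pure logic plus the tree identity selmerCorank = mordellWeilRank + shaCorank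
(WeierstrassCurve.selmerCorank_eq_mordellWeilRank_add_holds):
on each member of the supply the kernel at k = 2 gives s_p <= ord_T L_p <= 2, two points give 2 <= r
<= s_p, hence r = s_p = ord = 2
and shaCorank = 0; Set.Infinite.mono transports infinitude of discriminants. The Assembly item
restates this chain (provable by `closes`). The deciding theorem `closes` (glue.lean, sorry-free)
concludes the route-local leaf InfinitelyManyRankTwoPadicBSD (born draft until director-bsd
registers the leaf as a rung closer).

Rationale: WHY THIS LINE. A NON-EQUIVALENT CRITERION for the λ-door at rank 2: instead of certifying ord_T L_p
= 2 by modular symbols (LambdaDoorKernel,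
MatsunoAnalyticTwin, CountingDoorF2AtThree at p = 3, the p = 2 transports) or Ш-finiteness by an
Euler system (Kato/Kolyvagin routes,
capped at rank <= 1 by EulerSystemBigImageBarrier / StringentKolyvaginCapsAtMax), read λ EXACTLY off
the EISENSTEIN side:
Greenberg–Vatsal 2000 §3 (GreenbergVatsal2000; tree fact
nonPrimitive_unitContent_and_lambda_eq_residual_of_lineRamifiedEven_goodOrd)
gives μ(L_p·∏_Σ0 P_ℓ) = 0 and p^λ = the residual count — class groups and units of two Dirichlet
characters plus Euler-factor
orders (Greenberg1999 Prop. 5.10 and the printed twist formula λ_(E^ξ) = 2λ_ξ + ε_ξ for the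
conductor-11 curves at p = 5, LNM 1716
pp. 159–160). Count exponent 2 ⇒ ord_T L_p <= 2 (Wuthrich2014 integrality, Euler additivity in Λ/p,
ord does not drop mod p); two points +
Kummer (selmerCorank = rank + shaCorank, tree) + Kato 18.4 (Kato2004) squeeze r = s_p = ord_T L_p =
2 and corank Ш[p^∞] = 0. Imported
area: classical Iwasawa theory of number fields (Ferrero–Washington μ = 0, Gold/Sands/Byeon
λ-invariants of imaginary quadratic fields)
as the certificate; arithmetic statistics of quadratic twists (Stewart–Top doi:10.2307/2152834) as
the supply. What it does that listed
routes do not: λ is EXACT at an Eisenstein prime with μ = 0 (the census dictum «congruences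
transport ord >= only» does not apply), so
the door needs no numerics, no 2-descent and no modular symbol, and its open input is a statement
about class numbers and ranks in ONE
twist family — a different wall from NumericalVanishingBarrier / PAdicHeightBarrier /
SelmerRankBarrier.

RANKED CRUXES. #0 InfinitelyManyRankTwoPadicBSD (target) — the route-local leaf T: ∃ prime p >= 5
such that the set of discriminants Δ of globally minimal elliptic W/Q with good ordinary reduction
at p, rank W(Q) = 2, corank_p Ш = 0, corank Sel_p^∞ = 2 and ord_T L_p(f, α_W) = 2 for some newform f
of W is infinite (door (D) of S0-DOORS N4 with the MTT rank clause; a DOOR, not BSD). (why it might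
fail: as a leaf it is believed (Watkins/BKLPR heuristics: rank-2 twists abound and Ш is finite) but
every print certificate of ord_T L_p = 2 or #Ш < ∞ at rank 2 is per-curve numerics; infinitely many
certified members is exactly what no instrument delivers today.) [GreenbergVatsal2000,
Greenberg1999, MazurTateTeitelbaum1986Invent, SteinWuthrich2013]
#2 EisensteinCountTwoSupply (crux) — SUPPLY — ∃ prime p >= 5 and infinitely many (by discriminant)
globally minimal elliptic W/Q, good ordinary at p, with rank W(Q) >= 2 and a rational p-line Φ0 <
E[p], ramified and even at p, such that for the cyclotomic Z_p-extension and some finite Σ0 ∌ p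
containing the bad primes the Greenberg–Vatsal residual count #H¹_Σ0(Φ0)·#Sel_Σ0(E[p]/Φ0) equals
p^(2 + Σ_(ℓ∈Σ0) δ_ℓ). Model class (non-anomalous): odd quadratic twists 11a1^(d), p = 5, line
μ_5⊗χ_d, with 5 and 11 INERT in Q(√d) and λ_5(Q(√d)) = 1 (then a_5 = −1, count exponent = 2λ_5 +
ε_11 = 2 by Greenberg's formula; rank >= 2 there already forces 5 ∣ h(Q(√d)) by 5-isogeny descent)
and two independent points. [difficulty: open-problem] (why it might fail: rank 2 forces λ_E >= 2
but λ_E = 2λ_5(Q(√d)) EXACTLY 2 needs λ_5 = 1, i.e. a unit normalised 5-adic regulator; two points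
might correlate with λ_5 >= 2 (as anomalous 5 empirically does: kit j293312, 0/66), and planting
rank 2 in a λ-conditioned twist class is open.) [Greenberg1999, GreenbergVatsal2000,
doi:10.4064/aa120-2-2, arXiv:1212.1392, doi:10.2307/2152834, arXiv:2507.21339]
#3 PublishedInputs (crux) — PRINT PACK (crux only in the gate's auto-crux sense: hypotheses of
`closes` that nothing in the tree derives) — five named Literature facts used as hypotheses: (i)
Greenberg–Vatsal §3 residual structure at a good ordinary Eisenstein prime with Φ0 ramified and even
(unit content of b·∏P_ℓ and p^ord_T((b∏P_ℓ) mod p) = residual count); (ii) Wuthrich 2014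
divisibility char X ∣ (ϖ L_p) in the reducible case; (iii) modularity (a newform of level N_W
exists); (iv) the period ratio ϖ ∈ Q^× with ϖ·Ω_W = Ω_f^+; (v) Kato Thm 18.4: corank Sel_p^∞(E/Q) <=
ord_T L_p(f, α). [difficulty: L] (why it might fail: all five are theorems in print; the risk is
TYPING — the tree's normalisations (plusPeriod vs realPeriodRat, the unit root α,
iwasawaToPowerSeries) could make (i), (ii) or (iv) false as stated (a refuter kills a mis-normalised
fact, not the mathematics).) [GreenbergVatsal2000, Wuthrich2014, Kato2004,
MazurTateTeitelbaum1986Invent]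
#9 EisensteinCountDoorKernel (support) — DOOR KERNEL — from PublishedInputs: if W is good ordinary
at odd p with a rational p-line Φ0 ramified and even, κ cyclotomic, Σ0 ∌ p covers the bad primes and
the residual count equals p^(k + Σ δ_ℓ), then for some newform f of W, corank Sel_p^∞(W) <= ord_T
L_p(f, α_W) <= k. Proof plan (M): take γ, cyclotomic variable and D : SelmerDualData
(nonempty_selmerDualData_holds); Wuthrich gives g ∈ char X with ι g = ϖ·L_p; GV (i) with b = g gives
p^ord((g∏P) mod p) = count = p^(k+Σδ); order_map_toZMod_mul_eulerFactorProduct subtracts Σδ; ord_T g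
<= ord_T (g mod p) = k; ι preserves order and ϖ ≠ 0; Kato is input (v). [difficulty: M]
[GreenbergVatsal2000, Wuthrich2014, Kato2004]

TWO-LAYER PLAN. Foreseen split of the crux once typed class-group vocabulary exists:
EisensteinCountTwoSupply ⇐ InertClassRankTwoTwists (infinitely many
fundamental d < 0 with (d/5) = (d/11) = −1, rank 11a1^(d)(Q) >= 2 and λ_5(Q(√d)) = 1 — rank >= 2
already forces 5 ∣ h, so the
condition is «λ minimal») → GreenbergTwistCount (for every such d the residual count of 11a1^(d) at
5 with Φ0 = μ_5⊗χ_d and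
Σ0 = {11, ℓ ∣ d} is 5^(2+Σδ): Greenberg's printed formula, M/L) → EisensteinCountTwoSupply. BC3
birth skeleton (folder bc/):
stub_rankTwoIsogenyFamily (print) → stub_countTwoNotAvoided (open, dichotomy form) → crux,
kernel-checked. A second
supply family (X_1(5)-isogenous curves E_b with b²−11b−1 controlled) is an alternative child, not
filed now. Optional extension (not an
item): on the supply GV Thm 1.3 gives the main conjecture, hence Schneider nondegeneracy and BSD_p
leading term for free (feeds N3).

KILL CRITERIA. Refutation of EisensteinCountDoorKernel as typed (e.g. a rank-2 curve in the model
class whose certified ord_T L_5 exceeds 2 —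
instrument row: SteinWuthrich2013 / Wuthrich overconvergent modular symbols λ-certificates vs the
class-group count on 20 members) closes
the route `refuted:EisensteinCountDoorKernel` (the bookkeeping 2λ_ξ+ε would then be mis-typed in the
tree vocabulary). A theorem (or overwhelming data, instrument: PARI/Magma twist tables + Iwasawa λ
of Q(√d)) that rank >= 2 forces λ_5(Q(√d)) >= 2 on the
5-inert 11a1-twists — as anomaly empirically does on the 5-split ones — refutes the model class and
forces a pivot to the X_1(5) / X_0(7)
families; if that is also obstructed, close `refuted:EisensteinCountTwoSupply`. A class-wide rank-2
Ш-finiteness theorem elsewhere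
(KolyvaginDepthDoor/ShaPrimaryTransfer O) moots the door but not the MTT clause.

NOT DECOMPOSED YET. The concrete door class (Kronecker conditions (d/5) = (d/11) = −1, λ_5(Q(√d)) =
1) is kept in words: the tree has no Iwasawa
λ of a number field's class-group module nor the Kronecker character as a DirichletCharacter, so the
crux is typed by the residual
count itself; the split GoldClassRankTwoTwists → GreenbergTwistCount is layer 2. No regime split in
p: p = 5 with 11a1-twists is the
intended witness prime, p = 7 (X_0(7)-isogenies, 26b1-type) the spare.

CHEAPEST FALSIFIER. (1) RAN: kit j293312 (PARI, 5 s): the ANOMALOUS sub-class (5 split in Q(√d), 5 ∤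
h, Gold λ_5 = 1, (d/11) ≠ 1, |d| <= 1500) has 66
members and 0 of analytic rank >= 2 — explained after the fact: 5 split ⇒ a_5(E^(d)) = 1 anomalous ⇒
the p-adic BSD leading term
carries (#Ẽ(F_5))² ∼ 5², so rank 2 gives λ_E >= 4 unless v_5(Reg_5/25) = −2; that sub-class is
dropped. Pending: kit j293537, the
NON-anomalous class ((d/5) = (d/11) = −1, |d| <= 2500): rank-2 members with h, Cl structure; zero
rank-2 members with cyclic 5-part
of Cl would make the supply implausible; one with λ_5 = 1 certified (Dummit–Ford–Kisilevsky–Sands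
method) is the BC5 rung. (2) For the kernel: compare count exponent 2λ_ξ+ε_ξ
with the SteinWuthrich2013 λ-certificates (ord_T L_5) on the first 20 rank-2 members — one mismatch
kills the typed chain.

NUMBERS. kit j293312: anomalous sub-class |d| <= 1500: 66 members, 0 with r_an >= 2. Greenberg LNM
1716 p. 160: Q(√−1): λ_5 = 1, 11 inert ⇒ λ_(E^ξ) = 2 with rank 0 (176b, anomalous); Q(√−2): λ = 0,
11 split ⇒ λ_E = 1, rank 1 (704);
Fukuda: λ_5(Q(√−3624233)) = 10 ⇒ λ_E = 21. Stewart–Top: #{|d| <= X : rank E^(d) >= 2} >>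
X^(1/7)/log² X. Kato 18.4: s_p <= ord_T L_p.
Items at open: 5 (1 target, 2 cruxes — one open, one print pack —, 1 support, 1 assembly).

DEFINITION REQUESTS. None filed now. Wanted later (layer 2): Iwasawa λ-invariant of the cyclotomic
Z_p-extension of a number field (class-group module X_∞ as
a Λ-module; `lambdaInvariant` of IwasawaAlgebra exists) and the Kronecker character χ_d as a
DirichletCharacter, to type GoldClassRankTwoTwists.

Novelty: Searches (2026-08-27): `lit search --hybrid "lambda invariant Selmer group quadratic twist isogeny
class number rank two Sha finite"`
(8: coates1999 pp.137–176 = Greenberg LNM1716; delbourgo2008; li2025 BSD rational curves (CM, rank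
<= 1); no rank-2 door);
`lit search "imaginary quadratic fields Iwasawa lambda invariant equal to one infinitely many"
--source all` (Byeon 2005
doi:10.4064/aa120-2-2, Ito arXiv:1212.1392, Sands 1993, Dummit–Ford–Kisilevsky–Sands 1991); `lit
search "Stewart Top ranks of twists…"`
(doi:10.2307/2152834); `lit read paper:arxiv-2412.07308` (Hatley–Ray: p = 2, Kida formula, ASSUMES Ш
finite, rank <= 1 statistics);
`lit read paper:arxiv-2507.21339` (2025 twist-family Iwasawa invariants: λ >= rank direction, Ш
finite assumed); `lit galaxy search
"5-isogeny|isogeny of degree 5|twists of X_0(11)" --star pdf` (8 hits, all cryptography/torsion,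
none relevant); `lit galaxy search
"Iwasawa invariants of quadratic twists|…" --star all` (0); `ledger negatives --problem
BirchSwinnertonDyer` (1, unrelated);
`lean search` for residual-count consumers (only Rank1Residual X2 = rank <= 1 main-conjecture
transfer, EisensteinPrimes cell).
Nearest prior art found: [corpus:book:coates1999-arithmetic-theory-elliptic-curves p.159–160]
Greenberg 1999, twist formula
λ_(E^ξ) = 2λ_ξ + ε_ξ at p = 5 for conductor-11 curves with rank-0/1 examples and a rank-0 λ = 2
example (Ш-type λ); GreenbergVatsal2000
§3 (the general residual count, used for the MAIN CONJECTURE); [corpus:paper:  [refs: 10.4064/aa120-2-2, 10.2307/2152834, 1212.1392, doi:10.4064/aa120-2-2, doi:10.2307/2152834, paper:arxiv-2412.07308, paper:arxiv-2507.21339, book:coates1999-arithmetic-theory-elliptic-curves, GreenbergVatsal2000]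

Barriers (technique_class: iwasawa-eisenstein-congruence, arithmetic-statistics): - technique_class: iwasawa-eisenstein-congruence, arithmetic-statistics
- Literature.Barriers.BirchSwinnertonDyer.EisensteinMuBarrier: outside — the crux REQUIRES Φ0
ramified and EVEN (GV parity), exactly the hypothesis under which μ = 0 is Greenberg's Prop. 5.10 /
Ferrero–Washington; the barrier's positive-μ classes (ramified-odd lines, Prop. 5.7) are excluded by
the signature (¬LineUnramifiedAt ∧ LineEven).
- Literature.Barriers.BirchSwinnertonDyer.EulerSystemBigImageBarrier: outside — no Euler-system
divisibility at the Eisenstein prime is run to bound Ш; Kato enters only as the rank inequality s_p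
<= ord_T L_p (Thm 18.4, valid without big image), Ш-finiteness comes from the squeeze 2 <= r <= s_p
<= λ = 2.
- Literature.Barriers.BirchSwinnertonDyer.SelmerRankBarrier: outside — the line never infers rank
from a Selmer count: the two points are an INPUT of the supply crux; Selmer data only caps from
above.
- Literature.Barriers.BirchSwinnertonDyer.NumericalVanishingBarrier: outside — ord_T L_p = 2 is
certified algebraically (count ⇒ ord <= 2, Kato + points ⇒ ord >= 2); no numerical evaluation of a
derivative or of L_p is used.
- Literature.Barriers.BirchSwinnertonDyer.PAdicHeightBarrier: not touched — the door delivers the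
rank clause and Ш[p^∞]-finiteness, not the leading term; Schneider's conjecture is not claimed (it
would follow on the supply from GV Thm 1.3 + Perrin-Riou/Schneider only as an unfiled extension).
- Literature.Barriers.BirchSwinnertonDyer.StringentKolyvagin

sub-problem: BirchSwinnertonDyer · status: draft · opened planner-bsd-idea-4-g2-0 2026-08-27T23:19:04Z · rev 0 · ledger route-BirchSwinnertonDyer-EisensteinCountDoorRankTwo
GENERATED by the gate from the ledger (D-0016/17). Provers cite these decls: `theorem foo : Summit.BirchSwinnertonDyer.BirchSwinnertonDyer.Theses.EisensteinCountDoorRankTwo.<Decl> := …` in Summits/BirchSwinnertonDyer/BirchSwinnertonDyer/Theorems/<Name>.lean.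
-/

namespace Summit.BirchSwinnertonDyer.BirchSwinnertonDyer.Theses.EisensteinCountDoorRankTwo

open scoped BigOperators Topology Manifold Classical MeasureTheory ProbabilityTheory Matrix InnerProductSpace ComplexConjugate ContinuousMap
open Filter Set Function TopologicalSpace MeasureTheory

attribute [summit_statement] _root_.BirchSwinnertonDyer

open Literature

/-- item stmt-BirchSwinnertonDyer-23552 · target · rank 0 · open · by planner
why it might fail: as a leaf it is believed (Watkins/BKLPR heuristics: rank-2 twists abound and Ш is finite) but every print certificate of ord_T L_p = 2 or #Ш < ∞ at rank 2 is per-curve numerics; infinitely many certified members is exactly what no instrument delivers today.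
sources: GreenbergVatsal2000, Greenberg1999, MazurTateTeitelbaum1986Invent, SteinWuthrich2013
[target] the route-local leaf T: ∃ prime p >= 5 such that the set of discriminants Δ of globally
minimal elliptic W/Q with good ordinary reduction at p, rank W(Q) = 2, corank_p Ш = 0, corank
Sel_p^∞ = 2 and ord_T L_p(f, α_W) = 2 for some newform f of W is infinite (door (D) of S0-DOORS N4
with the MTT rank clause; a DOOR, not BSD). -/
@[route_item "route-BirchSwinnertonDyer-EisensteinCountDoorRankTwo"]
def InfinitelyManyRankTwoPadicBSD : Prop :=
  ∃ (p : ℕ) (_ : Fact p.Prime), 5 ≤ p ∧ {Δ : ℚ | ∃ (W : WeierstrassCurve ℚ) (_ : W.IsElliptic) (_ : W.IsGloballyMinimal), W.Δ = Δ ∧ W.HasGoodReductionAtPrime p ∧ ¬ (p : ℤ) ∣ W.frobeniusTrace p ∧ W.mordellWeilRank = 2 ∧ W.shaCorank p = 0 ∧ W.selmerCorank p = 2 ∧ ∃ (N : ℕ) (_ : NeZero N) (f : CuspForm (CongruenceSubgroup.Gamma0 N) 2), NumberTheory.EllipticCurves.ModularForms.IsNewformOf W f ∧ (NumberTheory.EllipticCurves.padicLFunction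 f (NumberTheory.EllipticCurves.unitRoot W p : ℚ_[p])).order = 2}.Infinite

/-- item stmt-BirchSwinnertonDyer-23553 · crux · rank 2 · open · by planner
why it might fail: rank 2 forces λ_E >= 2 but λ_E = 2λ_5(Q(√d)) EXACTLY 2 needs λ_5 = 1, i.e. a unit normalised 5-adic regulator; two points might correlate with λ_5 >= 2 (as anomalous 5 empirically does: kit j293312, 0/66), and planting rank 2 in a λ-conditioned twist class is open.
sources: Greenberg1999, GreenbergVatsal2000, doi:10.4064/aa120-2-2, arXiv:1212.1392, doi:10.2307/2152834, arXiv:2507.21339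
[crux] SUPPLY — ∃ prime p >= 5 and infinitely many (by discriminant) globally minimal elliptic W/Q,
good ordinary at p, with rank W(Q) >= 2 and a rational p-line Φ0 < E[p], ramified and even at p,
such that for the cyclotomic Z_p-extension and some finite Σ0 ∌ p containing the bad primes the
Greenberg–Vatsal residual count #H¹_Σ0(Φ0)·#Sel_Σ0(E[p]/Φ0) equals p^(2 + Σ_(ℓ∈Σ0) δ_ℓ). Model class
(non-anomalous): odd quadratic twists 11a1^(d), p = 5, line μ_5⊗χ_d, with 5 and 11 INERT in Q(√d)
and λ_5(Q(√d)) = 1 (then a_5 = −1, count exponent = 2λ_5 + ε_11 = 2 by Greenberg's formula; rank >=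
2 there already forces 5 ∣ h(Q(√d)) by 5-isogeny descent) and two independent points. [difficulty:
open-problem] -/
@[route_item "route-BirchSwinnertonDyer-EisensteinCountDoorRankTwo", crux]
def EisensteinCountTwoSupply : Prop :=
  ∃ (p : ℕ) (_ : Fact p.Prime), 5 ≤ p ∧ {Δ : ℚ | ∃ (W : WeierstrassCurve ℚ) (_ : W.IsElliptic) (_ : W.IsGloballyMinimal), W.Δ = Δ ∧ W.HasGoodReductionAtPrime p ∧ ¬ (p : ℤ) ∣ W.frobeniusTrace p ∧ 2 ≤ W.mordellWeilRank ∧ ∃ (Φ₀ : AddSubgroup (W.geomTorsion (p : ℤ))) (hΦ : NumberTheory.EllipticCurves.Rank1Residual.IsRationalLine W p Φ₀), ¬ NumberTheory.EllipticCurves.Rank1Residual.LineUnramifiedAt W p Φ₀ ∧ NumberTheory.EllipticCurves.Rank1Residual.LineEven W p Φ₀ ∧ ∃ κ : NumberTheory.EllipticCurves.ZpExtension ℚ p, κ.IsCyclotomic ∧ ∃ S₀ : Finset (IsDedekindDomain.HeightOneSpectrum (NumberField.RingOfIntegers ℚ)), (∀ v ∈ S₀, ((p : ℕ) : NumberField.RingOfIntegers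 ℚ) ∉ v.asIdeal) ∧ (∀ v : IsDedekindDomain.HeightOneSpectrum (NumberField.RingOfIntegers ℚ), v ∉ S₀ → ((p : ℕ) : NumberField.RingOfIntegers ℚ) ∉ v.asIdeal → W.HasGoodReductionAt v) ∧ Nat.card (NumberTheory.EllipticCurves.GreenbergVatsal2000.residualLineH1 W p κ S₀ Φ₀ hΦ) * Nat.card (NumberTheory.EllipticCurves.GreenbergVatsal2000.residualQuotSelmer W p κ S₀ Φ₀ hΦ) = p ^ (2 + ∑ v ∈ S₀, NumberTheory.EllipticCurves.GreenbergVatsal2000.delta W p v)}.Infinite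

/-- item stmt-BirchSwinnertonDyer-23554 · crux · rank 3 · open · by planner
why it might fail: all five are theorems in print; the risk is TYPING — the tree's normalisations (plusPeriod vs realPeriodRat, the unit root α, iwasawaToPowerSeries) could make (i), (ii) or (iv) false as stated (a refuter kills a mis-normalised fact, not the mathematics).
sources: GreenbergVatsal2000, Wuthrich2014, Kato2004, MazurTateTeitelbaum1986Invent
[crux] PRINT PACK (crux only in the gate's auto-crux sense: hypotheses of `closes` that nothing in
the tree derives) — five named Literature facts used as hypotheses: (i) Greenberg–Vatsal §3 residual
structure at a good ordinary Eisenstein prime with Φ0 ramified and even (unit content of b·∏P_ℓ and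
p^ord_T((b∏P_ℓ) mod p) = residual count); (ii) Wuthrich 2014 divisibility char X ∣ (ϖ L_p) in the
reducible case; (iii) modularity (a newform of level N_W exists); (iv) the period ratio ϖ ∈ Q^× with
ϖ·Ω_W = Ω_f^+; (v) Kato Thm 18.4: corank Sel_p^∞(E/Q) <= ord_T L_p(f, α). [difficulty: L] -/
@[route_item "route-BirchSwinnertonDyer-EisensteinCountDoorRankTwo", crux]
def PublishedInputs : Prop :=
  NumberTheory.EllipticCurves.GreenbergVatsal2000.nonPrimitive_unitContent_and_lambda_eq_residual_of_lineRamifiedEven_goodOrd ∧ NumberTheory.EllipticCurves.Wuthrich2014.charIdeal_dvd_padicLFunction ∧ NumberTheory.EllipticCurves.ModularForms.exists_isNewformOf ∧ (∀ (W : WeierstrassCurve ℚ) [W.IsElliptic] [W.IsGloballyMinimal] {N : ℕ} [NeZero N] (f : CuspForm (CongruenceSubgroup.Gamma0 N) 2), NumberTheory.EllipticCurves.ModularForms.IsNewformOf W f → ∃ ϖ : ℚ, ϖ ≠ 0 ∧ (ϖ : ℝ) * W.realPeriodRat = NumberTheory.EllipticCurves.ModularForms.plusPeriod f) ∧ (∀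 (W : WeierstrassCurve ℚ) [W.IsElliptic] [W.IsGloballyMinimal] (p : ℕ) [Fact p.Prime] {N : ℕ} [NeZero N] (f : CuspForm (CongruenceSubgroup.Gamma0 N) 2), NumberTheory.EllipticCurves.kato_selmerCorank_le_order_padicLFunction_allPrimes W p (f := f))

/-- item stmt-BirchSwinnertonDyer-23555 · support · rank 9 · closed · proved by Summit.BirchSwinnertonDyer.BirchSwinnertonDyer.Theorems.eisensteinCountDoorKernel_proof (prover) · by planner
sources: GreenbergVatsal2000, Wuthrich2014, Kato2004
[support] DOOR KERNEL — from PublishedInputs: if W is good ordinary at odd p with a rational p-line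
Φ0 ramified and even, κ cyclotomic, Σ0 ∌ p covers the bad primes and the residual count equals p^(k
+ Σ δ_ℓ), then for some newform f of W, corank Sel_p^∞(W) <= ord_T L_p(f, α_W) <= k. Proof plan (M):
take γ, cyclotomic variable and D : SelmerDualData (nonempty_selmerDualData_holds); Wuthrich gives g
∈ char X with ι g = ϖ·L_p; GV (i) with b = g gives p^ord((g∏P) mod p) = count = p^(k+Σδ);
order_map_toZMod_mul_eulerFactorProduct subtracts Σδ; ord_T g <= ord_T (g mod p) = k; ι preserves
order and ϖ ≠ 0; Kato is input (v). [difficulty: M] -/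
@[route_item "route-BirchSwinnertonDyer-EisensteinCountDoorRankTwo", crux]
def EisensteinCountDoorKernel : Prop :=
  PublishedInputs → ∀ (W : WeierstrassCurve ℚ) [W.IsElliptic] [W.IsGloballyMinimal] (p : ℕ) [Fact p.Prime] (k : ℕ), p ≠ 2 → W.HasGoodReductionAtPrime p → ¬ (p : ℤ) ∣ W.frobeniusTrace p → ∀ (Φ₀ : AddSubgroup (W.geomTorsion (p : ℤ))) (hΦ : NumberTheory.EllipticCurves.Rank1Residual.IsRationalLine W p Φ₀), ¬ NumberTheory.EllipticCurves.Rank1Residual.LineUnramifiedAt W p Φ₀ → NumberTheory.EllipticCurves.Rank1Residual.LineEven W p Φ₀ → ∀ κ : NumberTheory.EllipticCurves.ZpExtension ℚ p, κ.IsCyclotomic → ∀ S₀ : Finset (IsDedekindDomain.HeightOneSpectrum (NumberField.RingOfIntegers ℚ)), (∀ v ∈ S₀, ((p : ℕ) : NumberField.RingOfIntegers ℚ) ∉ v.asIdeal) → (∀ v : IsDedekindDomain.HeightOneSpectrum (NumberField.RingOfIntegers ℚ), v ∉ S₀ → ((p : ℕ) : NumberField.RingOfIntegers ℚ) ∉ v.asIdeal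 → W.HasGoodReductionAt v) → Nat.card (NumberTheory.EllipticCurves.GreenbergVatsal2000.residualLineH1 W p κ S₀ Φ₀ hΦ) * Nat.card (NumberTheory.EllipticCurves.GreenbergVatsal2000.residualQuotSelmer W p κ S₀ Φ₀ hΦ) = p ^ (k + ∑ v ∈ S₀, NumberTheory.EllipticCurves.GreenbergVatsal2000.delta W p v) → ∃ (N : ℕ) (_ : NeZero N) (f : CuspForm (CongruenceSubgroup.Gamma0 N) 2), NumberTheory.EllipticCurves.ModularForms.IsNewformOf W f ∧ (W.selmerCorank p : ℕ∞) ≤ (NumberTheory.EllipticCurves.padicLFunction f (NumberTheory.EllipticCurves.unitRoot W p : ℚ_[p])).order ∧ (NumberTheory.EllipticCurves.padicLFunction f (NumberTheory.EllipticCurves.unitRoot W p : ℚ_[p])).order ≤ (k : ℕ∞)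

-- `EisensteinCountDoorKernel` holds: proved by `Summit.BirchSwinnertonDyer.BirchSwinnertonDyer.Theorems.eisensteinCountDoorKernel_proof` (its module imports this route file, so no `_holds` link can be stated here).

/-- item stmt-BirchSwinnertonDyer-23556 · assembly · rank 1 · closed · proved by Summit.BirchSwinnertonDyer.BirchSwinnertonDyer.Theorems.eisensteinCountDoorRankTwo_assembly_proof (prover) · by planner
sources: GreenbergVatsal2000, Kato2004
[assembly] EisensteinCountTwoSupply → PublishedInputs → EisensteinCountDoorKernel →
InfinitelyManyRankTwoPadicBSD (the leaf; NOT Summit.BirchSwinnertonDyer). -/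
@[route_item "route-BirchSwinnertonDyer-EisensteinCountDoorRankTwo"]
def Assembly : Prop :=
  EisensteinCountTwoSupply → PublishedInputs → EisensteinCountDoorKernel → InfinitelyManyRankTwoPadicBSD

-- `Assembly` holds: proved by `Summit.BirchSwinnertonDyer.BirchSwinnertonDyer.Theorems.eisensteinCountDoorRankTwo_assembly_proof` (its module imports this route file, so no `_holds` link can be stated here).

/-! D-0027 §2.1 — DECIDING THEOREM (planner-authored via `route open/edit --closes-file`; by planner-bsd-idea-4-g2-0 2026-08-27T23:19:04Z):
its hypotheses are this route's items and its conclusion the sub-problem Statement (glue_lint), and it elaborates with this file. -/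

@[closes "route-BirchSwinnertonDyer-EisensteinCountDoorRankTwo"] theorem closes (hS : EisensteinCountTwoSupply) (hIn : PublishedInputs)
    (hK : EisensteinCountDoorKernel) : InfinitelyManyRankTwoPadicBSD := by
  obtain ⟨p, hp, h5, hinf⟩ := hS
  refine ⟨p, hp, h5, hinf.mono ?_⟩
  rintro Δ ⟨W, hE, hM, hΔ, hgood, hord, hr, Φ₀, hΦ, hram, heven, κ, hκ, S₀, hS₁, hS₂, hcount⟩
  have hp2 : p ≠ 2 := by omega
  obtain ⟨N, hN, f, hf, hkato, hle⟩ :=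
    hK hIn W p 2 hp2 hgood hord Φ₀ hΦ hram heven κ hκ S₀ hS₁ hS₂ hcount
  have hs2 : W.selmerCorank p ≤ 2 := by exact_mod_cast hkato.trans hle
  have hid : W.selmerCorank p = W.mordellWeilRank + W.shaCorank p :=
    WeierstrassCurve.selmerCorank_eq_mordellWeilRank_add_holds W p
  have hsel : W.selmerCorank p = 2 := by omega
  refine ⟨W, hE, hM, hΔ, hgood, hord, by omega, by omega, hsel, N, hN, f, hf, le_antisymm hle ?_⟩
  have : ((2 : ℕ) : ℕ∞) ≤ (NumberTheory.EllipticCurves.padicLFunction f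
      (NumberTheory.EllipticCurves.unitRoot W p : ℚ_[p])).order := by
    rw [← hsel]; exact hkato
  exact_mod_cast this

end Summit.BirchSwinnertonDyer.BirchSwinnertonDyer.Theses.EisensteinCountDoorRankTwo
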